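import Summits.BirchSwinnertonDyer.BirchSwinnertonDyer.Theorems.CyclotomicUntwistSecondKindLogForm
import Mathlib.RingTheory.PowerSeries.Expand
import HarnessLib

/-!
# Route `CyclotomicUntwist`: the Honda recursion `log_W(X^{pⁿ}) ≡ αₙ·log_W + βₙ·log_W(Xᵖ) (mod ℤ_p⟦X⟧)` and its
# `p`-adic decay on a supersingular `V/ℤ_p` (preparation for Katz's rank 2, binder H3 of the W4 assembly)

Cell `pub/bsd-wall` (D-0145 line `route-BirchSwinnertonDyer-CyclotomicUntwist`), prover seat `bsd-line-cycu-p3` (gen 8),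
memo `KATZ-FROBENIUS-MOD-VARPI-v2` §2, work package W3; stub `stub_KATZ_rankLeTwo_supersingular` of
K1 = stmt-BirchSwinnertonDyer-21580 via cycu-p4's W4 assembly (`katz_dieudonne_rank_le_two_of_padicRankTwo : H3 → …`).
THEOREMS ONLY; `--supports` K1. BSD is not proved by this file and no crux is.

## The argument (general odd `p`, `a = HasseManin.tr (V ⊗ 𝔽_p)` with `p ∣ a`)

With `T = expand p` (`f ↦ f(Xᵖ)`) and `ℓ = log_W`:
* §1 the Honda recursion: `Tⁿℓ ≡ αₙ·ℓ + βₙ·Tℓ (mod ℤ_p⟦X⟧)` with `α, β : ℕ → ℤ`, `x₀, x₁ ∈ {0,1}`,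
  `x_{n+2} = a·x_{n+1} − p·xₙ` (from `T²ℓ = a·Tℓ − p·ℓ + p·hondaShift ℓ`, the tree's Honda type of `log_W`), and the decay
  `‖xₙ‖ ≤ ‖p‖^{⌊n/2⌋}` when `p ∣ a`;
* §2 coefficients: `[X^D] Tᴺφ = 0` for `D < pᴺ` (`φ(0) = 0`), `Tᴺ` preserves integrality.
(The iteration of the digit step, the `p`-adic limit and the theorem H3 follow in `CyclotomicUntwistSecondKindRankTwo`.)

[cite: Katz1981CrystallineDieudonne, Thm. 5.3.3] [cite: Honda1970, Thm. 9] [cite: Hazewinkel1978, Ch. I §2]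
-/

set_option autoImplicit false
-- single-conjunct summit: `Summit.BirchSwinnertonDyer.BirchSwinnertonDyer.…` repeats the name by design
set_option linter.dupNamespace false

noncomputable section

open PowerSeries Literature.NumberTheory.EllipticCurves
open Literature.RingTheory.FormalGroups (hondaShift prime_ne_zero prime_sq_ne_zero)

namespace Summit.BirchSwinnertonDyer.BirchSwinnertonDyer.Theorems.SecondKindLog

variable {p : ℕ} [hp : Fact p.Prime]

/-! ## §1 The Honda recursion `Tⁿℓ ≡ αₙℓ + βₙTℓ` and its decay -/

/-- `expand` only depends on the exponent (proof-irrelevant restatement for rewriting `p² = p·p`). [folklore] -/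
theorem expand_congr {R : Type*} [CommRing R] {m n : ℕ} (h : m = n) (hm : m ≠ 0) (hn : n ≠ 0) (φ : R⟦X⟧) :
    expand m hm φ = expand n hn φ := by
  subst h; rfl

/-- `Tⁿ` preserves `p`-integrality. [folklore] -/
theorem isPadicInt_expand_pow {φ : ℚ_[p]⟦X⟧} (hφ : IsPadicInt φ) (N : ℕ) :
    IsPadicInt ((expand p hp.out.ne_zero ^ N) φ) := by
  induction N with
  | zero => rwa [pow_zero, AlgHom.one_apply]
  | succ N ih =>
    rw [pow_succ', AlgHom.mul_apply]
    refine isPadicInt_iff_coeff.mpr fun n ↦ ?_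
    rw [coeff_expand]
    split_ifs
    · exact isPadicInt_iff_coeff.mp ih _
    · rw [norm_zero]; exact zero_le_one

/-- `[X^D](Tᴺφ) = 0` for `D < pᴺ` when `φ(0) = 0`. [folklore] -/
theorem coeff_expand_pow_eq_zero {φ : ℚ_[p]⟦X⟧} (hφ : constantCoeff φ = 0) {N D : ℕ} (hD : D < p ^ N) :
    coeff D ((expand p hp.out.ne_zero ^ N) φ) = 0 := by
  induction N generalizing D with
  | zero =>
    rw [pow_zero] at hD
    rw [pow_zero, AlgHom.one_apply, show D = 0 by omega, coeff_zero_eq_constantCoeff_apply, hφ]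
  | succ N ih =>
    rw [pow_succ', AlgHom.mul_apply, coeff_expand]
    split_ifs with h
    · obtain ⟨D', rfl⟩ := h
      rw [Nat.mul_div_cancel_left _ hp.out.pos]
      refine ih ?_
      rw [pow_succ'] at hD
      exact Nat.lt_of_mul_lt_mul_left hD
    · rfl

omit hp in
/-- The Honda recursion `x_{n+2} = a·x_{n+1} − p·x_n` on `ℤ` with initial values `x₀, x₁`. [folklore] -/
theorem hondaSeq_exists (a : ℤ) (x0 x1 : ℤ) :
    ∃ x : ℕ → ℤ, x 0 = x0 ∧ x 1 = x1 ∧ ∀ n, x (n + 2) = a * x (n + 1) - (p : ℤ) * x n := by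
  let x : ℕ → ℤ := fun n ↦ Nat.rec (motive := fun _ ↦ ℤ × ℤ) (x0, x1)
    (fun _ q ↦ (q.2, a * q.2 - (p : ℤ) * q.1)) n |>.1
  refine ⟨x, rfl, rfl, fun n ↦ ?_⟩
  show (Nat.rec (motive := fun _ ↦ ℤ × ℤ) (x0, x1) (fun _ q ↦ (q.2, a * q.2 - (p : ℤ) * q.1)) (n + 2)).1 = _
  rfl

/-- **Decay along the Honda recursion in the supersingular case**: if `p ∣ a`, `‖x₀‖, ‖x₁‖ ≤ 1`, then
`‖xₙ‖ ≤ ‖p‖^{⌊n/2⌋}` in `ℚ_p`. [folklore] -/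
theorem norm_hondaSeq_le {a : ℤ} (ha : (p : ℤ) ∣ a) {x : ℕ → ℤ} (h0 : ‖(x 0 : ℚ_[p])‖ ≤ 1) (h1 : ‖(x 1 : ℚ_[p])‖ ≤ 1)
    (hrec : ∀ n, x (n + 2) = a * x (n + 1) - (p : ℤ) * x n) (n : ℕ) :
    ‖(x n : ℚ_[p])‖ ≤ ‖(p : ℚ_[p])‖ ^ (n / 2) := by
  set r : ℝ := ‖(p : ℚ_[p])‖ with hr
  have hr0 : 0 ≤ r := norm_nonneg _
  have hr1 : r ≤ 1 := (Padic.norm_p_lt_one (p := p)).le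
  have hanorm : ‖(a : ℚ_[p])‖ ≤ r := by
    obtain ⟨a', rfl⟩ := ha
    rw [Int.cast_mul, Int.cast_natCast, norm_mul, hr]
    exact mul_le_of_le_one_right (norm_nonneg _) (Padic.norm_int_le_one a')
  -- two-step induction on the pair of bounds
  have key : ∀ m, ‖(x m : ℚ_[p])‖ ≤ r ^ (m / 2) ∧ ‖(x (m + 1) : ℚ_[p])‖ ≤ r ^ ((m + 1) / 2) := by
    intro m
    induction m with
    | zero => exact ⟨by simpa using h0, by simpa using h1⟩
    | succ m ih =>
      refine ⟨ih.2, ?_⟩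
      rw [show m + 1 + 1 = m + 2 from rfl, hrec m, Int.cast_sub, Int.cast_mul, Int.cast_mul, Int.cast_natCast,
        sub_eq_add_neg]
      refine (IsUltrametricDist.norm_add_le_max _ _).trans (max_le ?_ ?_)
      · rw [norm_mul]
        calc ‖(a : ℚ_[p])‖ * ‖(x (m + 1) : ℚ_[p])‖ ≤ r * r ^ ((m + 1) / 2) :=
              mul_le_mul hanorm ih.2 (norm_nonneg _) hr0
          _ = r ^ ((m + 1) / 2 + 1) := by rw [pow_succ, mul_comm]
          _ ≤ r ^ ((m + 2) / 2) := pow_le_pow_of_le_one hr0 hr1 (by omega)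
      · rw [norm_neg, norm_mul, ← hr]
        calc r * ‖(x m : ℚ_[p])‖ ≤ r * r ^ (m / 2) := mul_le_mul_of_nonneg_left ih.1 hr0
          _ = r ^ (m / 2 + 1) := by rw [pow_succ, mul_comm]
          _ = r ^ ((m + 2) / 2) := by congr 1; omega
  exact (key n).1

section Honda

variable (V : WeierstrassCurve ℤ_[p]) [hE : (V.map PadicInt.Coe.ringHom).IsElliptic]
  [hEt : (V.map PadicInt.toZMod).IsElliptic]

/-- **`T²ℓ = a·Tℓ − p·ℓ + p·hondaShift ℓ`** with `hondaShift ℓ ∈ ℤ_p⟦X⟧` (the Honda type of `log_W`, tree). [cite: Honda1970, Thm. 9] -/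
theorem expand_sq_formalLog_eq (hp2 : p ≠ 2) :
    ∃ S : ℚ_[p]⟦X⟧, IsPadicInt S ∧
      (expand p hp.out.ne_zero ^ 2) (V.map PadicInt.Coe.ringHom).formalLog =
        ((Literature.NumberTheory.EllipticCurves.HasseManin.tr (V.map PadicInt.toZMod) : ℤ) : ℚ_[p]) •
            expand p hp.out.ne_zero (V.map PadicInt.Coe.ringHom).formalLog -
          (p : ℚ_[p]) • (V.map PadicInt.Coe.ringHom).formalLog + (p : ℚ_[p]) • S := by
  set W := V.map PadicInt.Coe.ringHom with hWdef
  set a : ℤ := Literature.NumberTheory.EllipticCurves.HasseManin.tr (V.map PadicInt.toZMod) with hadef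
  have hp0 : (p : ℚ_[p]) ≠ 0 := by exact_mod_cast hp.out.ne_zero
  refine ⟨hondaShift p (a : ℚ_[p]) W.formalLog, isPadicInt_iff_coeff.mpr (V.norm_coeff_hondaShift_formalLog_le_one hp2), ?_⟩
  have hT2 : (expand p hp.out.ne_zero ^ 2) W.formalLog = expand (p ^ 2) (prime_sq_ne_zero p) W.formalLog := by
    rw [pow_two, AlgHom.mul_apply, ← expand_mul,
      ← expand_congr (sq p) (prime_sq_ne_zero p) (Nat.mul_ne_zero hp.out.ne_zero hp.out.ne_zero)]
  rw [hT2, WeierstrassCurve.hondaShift_eq_C_mul]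
  simp only [smul_eq_C_mul, nsmul_eq_mul, map_natCast]
  have hC : (p : ℚ_[p]⟦X⟧) * C ((p : ℚ_[p])⁻¹) = 1 := by
    rw [← map_natCast (C (R := ℚ_[p])) p, ← map_mul, mul_inv_cancel₀ hp0, map_one]
  linear_combination (C (a : ℚ_[p]) * expand p hp.out.ne_zero W.formalLog - expand (p ^ 2) (prime_sq_ne_zero p) W.formalLog -
    (p : ℚ_[p]⟦X⟧) * W.formalLog) * hC

/-- **The Honda recursion for `Tⁿℓ`**: integer sequences `α, β` with `α₀ = 1, α₁ = 0`, `β₀ = 0, β₁ = 1`,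
`x_{n+2} = a·x_{n+1} − p·xₙ`, and `Tⁿℓ − αₙℓ − βₙTℓ ∈ ℤ_p⟦X⟧` for all `n`. [cite: Honda1970, Thm. 9] -/
theorem exists_hondaSeq_expand_pow (hp2 : p ≠ 2) : ∃ α β : ℕ → ℤ,
    α 0 = 1 ∧ α 1 = 0 ∧ β 0 = 0 ∧ β 1 = 1 ∧
    (∀ n, α (n + 2) = (Literature.NumberTheory.EllipticCurves.HasseManin.tr (V.map PadicInt.toZMod) : ℤ) * α (n + 1) -
      (p : ℤ) * α n) ∧
    (∀ n, β (n + 2) = (Literature.NumberTheory.EllipticCurves.HasseManin.tr (V.map PadicInt.toZMod) : ℤ) * β (n + 1) -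
      (p : ℤ) * β n) ∧
    ∀ n, IsPadicInt ((expand p hp.out.ne_zero ^ n) (V.map PadicInt.Coe.ringHom).formalLog -
      (α n : ℚ_[p]) • (V.map PadicInt.Coe.ringHom).formalLog -
      (β n : ℚ_[p]) • expand p hp.out.ne_zero (V.map PadicInt.Coe.ringHom).formalLog) := by
  obtain ⟨S, hS, hS2⟩ := expand_sq_formalLog_eq V hp2
  set W := V.map PadicInt.Coe.ringHom with hWdef
  set a : ℤ := Literature.NumberTheory.EllipticCurves.HasseManin.tr (V.map PadicInt.toZMod) with hadef
  set T := expand p hp.out.ne_zero (R := ℚ_[p]) with hT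
  obtain ⟨α, hα0, hα1, hα⟩ := hondaSeq_exists (p := p) a 1 0
  obtain ⟨β, hβ0, hβ1, hβ⟩ := hondaSeq_exists (p := p) a 0 1
  refine ⟨α, β, hα0, hα1, hβ0, hβ1, hα, hβ, ?_⟩
  have hsmul : ∀ (z : ℤ) {Φ : ℚ_[p]⟦X⟧}, IsPadicInt Φ → IsPadicInt ((z : ℚ_[p]) • Φ) := fun z Φ hΦ ↦
    isPadicInt_iff_coeff.mpr fun n ↦ by
      rw [PowerSeries.coeff_smul, smul_eq_mul, norm_mul]
      exact mul_le_one₀ (Padic.norm_int_le_one z) (norm_nonneg _) (isPadicInt_iff_coeff.mp hΦ n)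
  -- two-step induction
  have key : ∀ n, IsPadicInt ((T ^ n) W.formalLog - (α n : ℚ_[p]) • W.formalLog - (β n : ℚ_[p]) • T W.formalLog) ∧
      IsPadicInt ((T ^ (n + 1)) W.formalLog - (α (n + 1) : ℚ_[p]) • W.formalLog - (β (n + 1) : ℚ_[p]) • T W.formalLog) := by
    intro n
    induction n with
    | zero =>
      rw [hα0, hα1, hβ0, hβ1, pow_zero, AlgHom.one_apply, zero_add, pow_one]
      simp only [Int.cast_one, Int.cast_zero, one_smul, zero_smul, sub_zero, sub_self]
      exact ⟨IsPadicInt.zero, IsPadicInt.zero⟩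
    | succ n ih =>
      refine ⟨ih.2, ?_⟩
      have e : (T ^ (n + 1 + 1)) W.formalLog - (α (n + 1 + 1) : ℚ_[p]) • W.formalLog -
          (β (n + 1 + 1) : ℚ_[p]) • T W.formalLog =
          (a : ℚ_[p]) • ((T ^ (n + 1)) W.formalLog - (α (n + 1) : ℚ_[p]) • W.formalLog - (β (n + 1) : ℚ_[p]) • T W.formalLog) -
          (p : ℚ_[p]) • ((T ^ n) W.formalLog - (α n : ℚ_[p]) • W.formalLog - (β n : ℚ_[p]) • T W.formalLog) +
          (p : ℚ_[p]) • (T ^ n) S := by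
        rw [show n + 1 + 1 = n + 2 from rfl, hα n, hβ n, pow_add, AlgHom.mul_apply, hS2, map_add, map_sub,
          map_smul, map_smul, map_smul, ← AlgHom.mul_apply, ← pow_succ]
        simp only [Int.cast_sub, Int.cast_mul, Int.cast_natCast]
        module
      rw [e]
      have h3 : IsPadicInt ((p : ℚ_[p]) • (T ^ n) S) := by
        have := hsmul (p : ℤ) (isPadicInt_expand_pow hS n)
        rwa [Int.cast_natCast] at this
      have h2 := hsmul (p : ℤ) ih.1
      rw [Int.cast_natCast] at h2
      exact ((hsmul a ih.2).sub h2).add h3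
  exact fun n ↦ (key n).1

end Honda

end Summit.BirchSwinnertonDyer.BirchSwinnertonDyer.Theorems.SecondKindLog
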